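import Literature.NumberTheory.EllipticCurves.QuadraticTwist
import Literature.NumberTheory.EllipticCurves.BSDInvariants
import Literature.NumberTheory.EllipticCurves.GlobalMinimalModel
import Literature.NumberTheory.EllipticCurves.Tamagawa
import HarnessLib

/-!
# Pal 2012, Thm. 3.2 with Prop. 2.5: the real period of the quadratic twist by a prime `p ≡ 1 (mod 4)` of a curve semistable at `p` (named fact, weaker than print)

Topic `NumberTheory/EllipticCurves`, sub-directory `Pal2012` (namespace = path). ONE named fact, weaker
than print, and nothing else. Written for the residual cell `b2b-bsdres` (seat additive-p4, chain V9
link [E]: the additive curve `E` of Kodaira type `I₀*`/`I_n*` at `p` is the twist `E♭ ⊗ χ_{p*}` of a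
curve `E♭` SEMISTABLE at `p`, and the BSD periods of `E` and `E♭` differ by `√p`).

## The printed statements (V. Pal, *Periods of quadratic twists of elliptic curves*, Proc. Amer. Math.
Soc. 140 (2012) 1513–1525 = arXiv:1012.0094, with an appendix by A. Agashe; held text)

* §1 (p. 1513) / §2: `E` "a minimal elliptic curve over `ℚ`" (global minimal model), `E^d` its
  quadratic twist by a square-free integer `d` (Connell's model, Lemma 2.2; `E^d_min` a minimal model of
  it); `Ω(E) = ∫_{E(ℝ)} |ω(E)|` the real period (number of components included, proof of Thm. 3.2,
  p. 1519); for `d < 0`, `Ω⁻(E)` the imaginary period and `c_∞` the number of real components.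
* **Proposition 2.5** (pp. 1516–1517): "Define `u_p` for all primes `p` as follows: If `p` is an odd
  prime divisor of `d`, then: if `λ_{v_p} < 6` or if `p = 3` and `v_p(c₆(E)) = 5`, then `u_p = 1`;
  otherwise `u_p = p` [`λ_v = min{3v(c₄(E)), 2v(c₆(E)), v(Δ)}`]. If `p` is an odd prime not dividing
  `d`, then `u_p = 1`. If `p = 2` then: if `d ≡ 1 mod 4`, then `u₂ = 1`; …" and `ũ = ∏_p u_p`, with
  (Lemma 3.1) `ω(E^d_min) = ũ · ω(E)/√d`.
* **Theorem 3.2** (p. 1519): "Recall that `E` is a minimal elliptic curve and `E^d` is its quadratic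
  twist by `d`. Then the periods of `E` and `E^d` are related as follows: if `d > 0`, then
  `Ω(E^d) = (ũ/√d) Ω(E)`; if `d < 0`, then `Ω(E^d) = (ũ/√d) c_∞(E^d) Ω⁻(E)`" (up to sign, proof p. 1519).

## The fact below (weaker than print)

The case `d = p` a prime with `p ≡ 1 (mod 4)` (so `d > 0`, `d ≡ 1 mod 4 ⇒ u₂ = 1`, `u_ℓ = 1` for odd
`ℓ ≠ p`) and `E` SEMISTABLE at `p` (good reduction: `v_p(Δ) = 0`; multiplicative: `v_p(c₄) = 0`; either
way `λ_{v_p} = 0 < 6 ⇒ u_p = 1`): then `ũ = 1` and Thm. 3.2 reads `Ω(E^d) = Ω(E)/√p` EXACTLY, i.e.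
`√p · Ω(E^d_min) = Ω(E)`. Typed with `E = W♭` (globally minimal, good or multiplicative at `p`) and
`E^d_min = W` ANY globally minimal model `ℚ`-isomorphic to the tree's quadratic twist
`W♭.quadraticTwist (p : ℚ)` (file `QuadraticTwist`; a change of variables `C` with
`C • W♭.quadraticTwist p = W`; `Ω` of a globally minimal model does not depend on the model,
`realPeriodRat_variableChange_of_isGloballyMinimal`), `Ω = realPeriodRat` (components included, as in
Pal). The case `d < 0` (`p ≡ 3 mod 4`, imaginary period `Ω⁻`) is NOT typed here (the tree has no
`Ω⁻` for Weierstrass curves yet). Weaker than print. No `_holds` (size S/M: Connell's minimal-model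
analysis Prop. 2.4 + the change of variables of the differential).

## References
* V. Pal, Proc. AMS 140 (2012) 1513–1525, Lemma 2.2, Prop. 2.4, Prop. 2.5, Lemma 3.1, Thm. 3.2. [Pal2012]
-/

noncomputable section

open scoped Classical

open WeierstrassCurve

namespace Literature.NumberTheory.EllipticCurves.Pal2012

/-- **Pal 2012, Thm. 3.2 + Prop. 2.5, case `d = p ≡ 1 (mod 4)`, `E` semistable at `p` (weaker than
print).** Let `V/ℚ` be a globally minimal elliptic curve with good or multiplicative reduction at a
prime `p ≡ 1 (mod 4)`, and let `W` be a globally minimal model of its quadratic twist by `p`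
(`C • V.quadraticTwist p = W` for some change of variables `C` over `ℚ`). Then the real periods
(components included) satisfy `√p · Ω(W) = Ω(V)` — Pal's `Ω(E^d) = (ũ/√d)·Ω(E)` with `ũ = 1`
(`u_p = 1` as `λ_{v_p}(E) = 0 < 6` at a semistable `p`; `u₂ = 1` as `d ≡ 1 mod 4`; `u_ℓ = 1` for odd
`ℓ ∤ d`). Weaker than print (special case). No `_holds`.
[cite: Pal2012, Thm. 3.2 (p. 1519) with Prop. 2.5 (pp. 1516–1517), Lemma 2.2, Lemma 3.1] -/
def thm32_sqrt_mul_realPeriodRat_twist_eq_of_prime_one_mod_four : Prop :=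
  ∀ (V W : WeierstrassCurve ℚ) [V.IsElliptic] [V.IsGloballyMinimal] [W.IsElliptic]
    [W.IsGloballyMinimal] (p : ℕ) [Fact p.Prime],
    p % 4 = 1 →
    (V.HasGoodReductionAtPrime p ∨ V.HasMultiplicativeReductionAtPrime p) →
    (∃ C : VariableChange ℚ, C • V.quadraticTwist (p : ℚ) = W) →
    Real.sqrt p * W.realPeriodRat = V.realPeriodRat

end Literature.NumberTheory.EllipticCurves.Pal2012

end
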